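import Summits.CriticalPhenomena.Ising3D.TaylorRegionDeltaLitOdd
import Mathlib.Tactic.Linarith
import Mathlib.Tactic.Positivity
import Mathlib.Tactic.Ring
import HarnessLib

/-!
# The TABLE layer of a derivative certificate, XXV: δ-expanded ROW TRIPLES for the ODD head layer (contract + discharge from the literal δ-tables)
(cell `pub-ising3x`, seat boot-1 gen 8; gate (g2) — rows half of the odd FAST head layer)

HONEST FRAMING: lottery ticket; floor = tightest certified 3D Ising CFT bounds; no exact-solution
claim without a proof. Island framing: certified exclusion region at stated derivative order and
assumptions; not a determination of the 3D Ising critical exponents beyond that.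

The odd head bracket `B(n,j)` (TaylorOddConeHeadQPoly) needs FIVE q-row families at `E = Δ + n`: `q̂₃` (component 2 of the
functional, exponent `s̄ = (Δσ+Δε)/2`, sign `−1`), `q̂₄` (component 3, `Δσ`, `−1`), `q̂₅` (component 4, `Δσ`, `+1`), `ψ̂₀` (the
majorant `Ψ`, `s = 0`, `σ = 0` — no box dependence) and `ψ̂_t` (`Ψ`, `s = t = Δσ − Δε`, `σ = 0`). These are EXACTLY the five literal
δ-row triple families `OddLit` of recog-1's wide-box odd-cone certificate (TaylorRegionDeltaOdd / …LitOdd: centres `b0, σ0, σ0, 0, t0`,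
half-widths `Wb, Wσ, Wσ, 0, Wt`). This file states the odd head layer's row contract on them and discharges it from the SAME literals:
* `OddHeadRowsΔ` — scale, usable row count `J`, box centres / half-widths, the literal rows `L : List OddLit` (plain variable `E`, `ccQ = 0`);
* `OddHeadRowsΔ.ValidΔ` — existential contract: for every `(Δσ, Δε)` of the box and `j < J`, real triples in `L[j]`'s five components
  whose `val3` (at the family's `δ`) are the five q-sums;
* **`OddHeadRowsΔ.validΔ_of_lit`** — `OddConeRegionDataΔ.tabOKc` (5 components × 3 orders), `rowLitOKL` for `j < J`, `sizesOK`,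
  `ccQ = 0` ⇒ `ValidΔ` (rows shared by the odd region layer and the odd head layer).
The cell theorem consuming it (`oddHead_nonneg_of_partsΔ`) is the next file. No new mathematics. [folklore]
-/

namespace Summit.CriticalPhenomena.Ising3D

open Finset Set
open Literature.Analysis.ValidatedNumerics Literature.Analysis.ValidatedNumerics.PolyMP
open Literature.Analysis.ValidatedNumerics.NumericsMP (MI)
open Literature.MathematicalPhysics.QuantumFieldTheory.ConformalBootstrap3D

/-- Row data of the δ-expanded ODD head layer: scale, usable rows `J`, box centres / half-widths, the literal five-family
row triples `L` (row `j ↦ (q̂₃-, q̂₄-, q̂₅-, ψ̂₀-, ψ̂_t-triple)`). [folklore] -/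
structure OddHeadRowsΔ where
  /-- fixed-point scale -/
  S : ℕ
  /-- rows `j < J` are usable -/
  J : ℕ
  /-- centre of the box in `Δσ` -/
  σ0 : ℚ
  /-- half-width in `Δσ` -/
  Wσ : ℚ
  /-- centre in `Δε` -/
  ε0 : ℚ
  /-- half-width in `Δε` -/
  Wε : ℚ
  /-- literal five-family row triples -/
  L : List OddLit

namespace OddHeadRowsΔ

variable (R : OddHeadRowsΔ)

/-- centre in `s̄` -/
def b0 : ℚ := (R.σ0 + R.ε0) / 2
/-- half-width in `s̄` -/
def Wb : ℚ := (R.Wσ + R.Wε) / 2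
/-- centre in `t = Δσ − Δε` -/
def t0 : ℚ := R.σ0 - R.ε0
/-- half-width in `t` -/
def Wt : ℚ := R.Wσ + R.Wε

/-- Row `j`'s literal. [folklore] -/
def lit (j : ℕ) : OddLit := R.L.getD j OddConeRegionDataΔ.noLit5

/-- Component `c`, order `m` row list (`c` = 0:q̂₃, 1:q̂₄, 2:q̂₅, 3:ψ̂₀, 4:ψ̂_t; `m` = δ-order). [folklore] -/
def rows (c m : ℕ) : List IPoly :=
  R.L.map fun t => match m with
    | 0 => (proj5 t c).1
    | 1 => (proj5 t c).2.1
    | _ => (proj5 t c).2.2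

/-- Reading the projected row lists off the literal. [folklore] -/
theorem getD_rows (c m j : ℕ) :
    (R.rows c m).getD j [] = match m with
      | 0 => (proj5 (R.lit j) c).1
      | 1 => (proj5 (R.lit j) c).2.1
      | _ => (proj5 (R.lit j) c).2.2 := by
  have key : ∀ (f : OddLit → IPoly), f OddConeRegionDataΔ.noLit5 = [] →
      (R.L.map f).getD j [] = f (R.L.getD j OddConeRegionDataΔ.noLit5) := fun f hf => by
    rw [← hf, List.getD_map]
  unfold rows lit
  rcases m with _ | _ | m
  · exact key _ (by rcases c with _ | _ | _ | _ | _ <;> rfl)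
  · exact key _ (by rcases c with _ | _ | _ | _ | _ <;> rfl)
  · exact key _ (by rcases c with _ | _ | _ | _ | _ <;> rfl)

/-- **δ-row validity, odd families** (the contract). [folklore] -/
def ValidΔ (c : Fin 5 → ℕ × ℕ → ℚ) (l : List (ℕ × ℕ)) (ψ : ℕ × ℕ → ℚ) (lψ : List (ℕ × ℕ))
    (σlo σhi εlo εhi : ℚ) : Prop :=
  0 < R.S ∧ 0 ≤ R.Wσ ∧ 0 ≤ R.Wε ∧
  ∀ p ∈ Icc (σlo : ℝ) σhi ×ˢ Icc (εlo : ℝ) εhi, |p.1 - R.σ0| ≤ R.Wσ ∧ |p.2 - R.ε0| ≤ R.Wε ∧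
    ∀ j < R.J,
      (∃ r : List ℝ × List ℝ × List ℝ, PMem3 R.S r (R.lit j).1 ∧
        ∀ E : ℝ, qSum (fun ab => (c 2 ab : ℝ)) l.toFinset ((p.1 + p.2) / 2) (-1) E j = val3 r E ((p.1 + p.2) / 2 - R.b0)) ∧
      (∃ r : List ℝ × List ℝ × List ℝ, PMem3 R.S r (R.lit j).2.1 ∧
        ∀ E : ℝ, qSum (fun ab => (c 3 ab : ℝ)) l.toFinset p.1 (-1) E j = val3 r E (p.1 - R.σ0)) ∧
      (∃ r : List ℝ × List ℝ × List ℝ, PMem3 R.S r (R.lit j).2.2.1 ∧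
        ∀ E : ℝ, qSum (fun ab => (c 4 ab : ℝ)) l.toFinset p.1 1 E j = val3 r E (p.1 - R.σ0)) ∧
      (∃ r : List ℝ × List ℝ × List ℝ, PMem3 R.S r (R.lit j).2.2.2.1 ∧
        ∀ E : ℝ, qSum (fun ab => (ψ ab : ℝ)) lψ.toFinset 0 0 E j = val3 r E 0) ∧
      (∃ r : List ℝ × List ℝ × List ℝ, PMem3 R.S r (R.lit j).2.2.2.2 ∧
        ∀ E : ℝ, qSum (fun ab => (ψ ab : ℝ)) lψ.toFinset (p.1 - p.2) 0 E j = val3 r E ((p.1 - p.2) - R.t0))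

/-- **`ValidΔ` from the literal δ-tables of a wide-box odd-cone certificate.** [folklore] -/
theorem validΔ_of_lit (d : OddConeRegionDataΔ) (TT : ITab3x5) (L : List OddLit) (J : ℕ) (hl : d.l.Nodup)
    (hlψ : d.lψ.Nodup) (hs : d.sizesOK = true) (hcc : d.ccQ = 0)
    (hT : ∀ c m : ℕ, c < 5 → m < 3 → d.tabOKc TT c m = true) (hr : ∀ j : ℕ, j < J → d.rowLitOKL TT L j = true) :
    (⟨d.S, J, d.σ0, d.Wσ, d.ε0, d.Wε, L⟩ : OddHeadRowsΔ).ValidΔ d.cQ d.l d.ψQ d.lψ d.σlo d.σhi d.εlo d.εhi := by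
  simp only [OddConeRegionDataΔ.sizesOK, OddConeRegionDataH.sizesOK, Bool.and_eq_true, decide_eq_true_eq] at hs
  obtain ⟨⟨⟨⟨⟨⟨⟨hsz, hσ⟩, hε⟩, hZ3⟩, hZ4⟩, hZ5⟩, hZψ0⟩, hZψt⟩ := hs
  obtain ⟨⟨⟨⟨⟨⟨⟨⟨hS, _⟩, _⟩, _⟩, _⟩, _⟩, _⟩, _⟩, _⟩ := hsz
  have hS : 0 < d.S := hS
  have hWσ : 0 ≤ d.Wσ := by unfold OddConeRegionDataΔ.Wσ; linarith
  have hWε : 0 ≤ d.Wε := by unfold OddConeRegionDataΔ.Wε; linarith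
  have hWb : 0 ≤ d.Wb := by unfold OddConeRegionDataΔ.Wb; linarith
  have hWt : 0 ≤ d.Wt := by unfold OddConeRegionDataΔ.Wt; linarith
  have t3 : ∀ m : ℕ, m < 3 → tabOK d.S (d.cQ 2) (-1) d.b0 d.Wb d.ccQ d.l TT.1 m = true :=
    fun m hm => hT 0 m (by norm_num) hm
  have t4 : ∀ m : ℕ, m < 3 → tabOK d.S (d.cQ 3) (-1) d.σ0 d.Wσ d.ccQ d.l TT.2.1 m = true :=
    fun m hm => hT 1 m (by norm_num) hm
  have t5 : ∀ m : ℕ, m < 3 → tabOK d.S (d.cQ 4) 1 d.σ0 d.Wσ d.ccQ d.l TT.2.2.1 m = true :=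
    fun m hm => hT 2 m (by norm_num) hm
  have tψ0 : ∀ m : ℕ, m < 3 → tabOK d.S d.ψQ 0 0 0 d.ccQ d.lψ TT.2.2.2.1 m = true :=
    fun m hm => hT 3 m (by norm_num) hm
  have tψt : ∀ m : ℕ, m < 3 → tabOK d.S d.ψQ 0 d.t0 d.Wt d.ccQ d.lψ TT.2.2.2.2 m = true :=
    fun m hm => hT 4 m (by norm_num) hm
  refine ⟨hS, hWσ, hWε, fun p hp => ?_⟩
  obtain ⟨h1, h2, h3, h4⟩ : (d.σlo : ℝ) ≤ p.1 ∧ p.1 ≤ d.σhi ∧ (d.εlo : ℝ) ≤ p.2 ∧ p.2 ≤ d.εhi := by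
    simp only [Set.mem_prod, Set.mem_Icc] at hp; exact ⟨hp.1.1, hp.1.2, hp.2.1, hp.2.2⟩
  have hδσ : |p.1 - d.σ0| ≤ d.Wσ := by
    unfold OddConeRegionDataΔ.σ0 OddConeRegionDataΔ.Wσ; push_cast; rw [abs_le]; constructor <;> linarith
  have hδε : |p.2 - d.ε0| ≤ d.Wε := by
    unfold OddConeRegionDataΔ.ε0 OddConeRegionDataΔ.Wε; push_cast; rw [abs_le]; constructor <;> linarith
  have hδb : |(p.1 + p.2) / 2 - d.b0| ≤ d.Wb := by
    unfold OddConeRegionDataΔ.b0 OddConeRegionDataΔ.Wb OddConeRegionDataΔ.σ0 OddConeRegionDataΔ.Wσ OddConeRegionDataΔ.ε0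
      OddConeRegionDataΔ.Wε
    push_cast; rw [abs_le]; constructor <;> linarith
  have hδt : |(p.1 - p.2) - d.t0| ≤ d.Wt := by
    unfold OddConeRegionDataΔ.t0 OddConeRegionDataΔ.Wt OddConeRegionDataΔ.σ0 OddConeRegionDataΔ.Wσ
      OddConeRegionDataΔ.ε0 OddConeRegionDataΔ.Wε
    push_cast; rw [abs_le]; constructor <;> linarith
  have hδ0 : |(0 : ℝ)| ≤ ((0 : ℚ) : ℝ) := by simp
  refine ⟨hδσ, hδε, fun j hj => ?_⟩
  have hcc' : ((d.ccQ : ℚ) : ℝ) = 0 := by rw [hcc]; push_cast; rfl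
  -- q-sums as triples
  have e3 := qSum_eq_delta_rows hS (d.cQ 2) (-1) d.b0 hWb d.ccQ hl hZ3 hδb
  have e4 := qSum_eq_delta_rows hS (d.cQ 3) (-1) d.σ0 hWσ d.ccQ hl hZ4 hδσ
  have e5 := qSum_eq_delta_rows hS (d.cQ 4) 1 d.σ0 hWσ d.ccQ hl hZ5 hδσ
  have eψ0 := qSum_eq_delta_rows hS d.ψQ 0 0 le_rfl d.ccQ hlψ hZψ0 hδ0
  have eψt := qSum_eq_delta_rows hS d.ψQ 0 d.t0 hWt d.ccQ hlψ hZψt hδt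
  have ab : ((d.b0 : ℚ) : ℝ) + ((p.1 + p.2) / 2 - d.b0) = (p.1 + p.2) / 2 := by ring
  have aσ : ((d.σ0 : ℚ) : ℝ) + (p.1 - d.σ0) = p.1 := by ring
  have a0 : (((0 : ℚ) : ℚ) : ℝ) + (0 : ℝ) = 0 := by simp
  have at' : ((d.t0 : ℚ) : ℝ) + ((p.1 - p.2) - d.t0) = p.1 - p.2 := by ring
  rw [ab] at e3; rw [aσ] at e4 e5; rw [a0] at eψ0; rw [at'] at eψt
  simp only [Rat.cast_neg, Rat.cast_one, Rat.cast_zero, hcc', sub_zero] at e3 e4 e5 eψ0 eψt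
  -- memberships in the triples from the literal tables, then in the literal rows
  have q3 := pmem3_tripL hS (d.cQ 2) (-1) d.b0 hWb d.ccQ d.l t3 d.N j hδb
  have q4 := pmem3_tripL hS (d.cQ 3) (-1) d.σ0 hWσ d.ccQ d.l t4 d.N j hδσ
  have q5 := pmem3_tripL hS (d.cQ 4) 1 d.σ0 hWσ d.ccQ d.l t5 d.N j hδσ
  have qψ0 := pmem3_tripL hS d.ψQ 0 0 le_rfl d.ccQ d.lψ tψ0 d.N j hδ0
  have qψt := pmem3_tripL hS d.ψQ 0 d.t0 hWt d.ccQ d.lψ tψt d.N j hδt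
  have hrow := hr j hj
  simp only [OddConeRegionDataΔ.rowLitOKL, OddConeRegionDataΔ.rowLitRowOK, Bool.and_eq_true] at hrow
  obtain ⟨⟨⟨⟨s3, s4⟩, s5⟩, sψ0⟩, sψt⟩ := hrow
  have m3 := pmem3_of_subset3 q3 s3
  have m4 := pmem3_of_subset3 q4 s4
  have m5 := pmem3_of_subset3 q5 s5
  have mψ0 := pmem3_of_subset3 qψ0 sψ0
  have mψt := pmem3_of_subset3 qψt sψt
  refine ⟨⟨_, m3, fun E => ?_⟩, ⟨_, m4, fun E => ?_⟩, ⟨_, m5, fun E => ?_⟩, ⟨_, mψ0, fun E => ?_⟩, ⟨_, mψt, fun E => ?_⟩⟩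
  · rw [e3 E j, show (⟨d.S, J, d.σ0, d.Wσ, d.ε0, d.Wε, L⟩ : OddHeadRowsΔ).b0 = d.b0 from rfl]; simp only [val3]
  · rw [e4 E j]; simp only [val3]
  · rw [e5 E j]; simp only [val3]
  · rw [eψ0 E j]; simp only [val3]
  · rw [eψt E j, show (⟨d.S, J, d.σ0, d.Wσ, d.ε0, d.Wε, L⟩ : OddHeadRowsΔ).t0 = d.t0 from rfl]; simp only [val3]

end OddHeadRowsΔ

end Summit.CriticalPhenomena.Ising3D
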